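import Summits.Ventures.PercRepro.S1TriangleKernelFive
import Summits.Ventures.PercRepro.S1TriangleBoundEightC

/-!
# PercRepro — THE (C3)-REFINED BOOTSTRAPPED TRIANGLE COUNT: `s₃ ≤ triBound8C ν` under (C1), (C2) and (C3) (p9, gen 29;
S4 — the row `37` of the `q = 7` window)

p8 g23's deletion induction (S1TriangleCountBootEight) WORD FOR WORD — at the point `x` on the fewest triangles
(`m := t_x`): `s₃ ≤ m + s₃(M ＼ {x})`, `|U| ≥ 2m + 1` and `|U|·m ≤ 3·s₃` on `U = ⋃ triangles`, and THE RESTRICTION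
STEP: the restriction `M ↾ U` has the same triangles; if its nullity is smaller the induction hypothesis bounds `s₃`
directly, otherwise `|U| ≥ r(U) + ν` with `r(U) ≥ 4` once `|U| ≥ 7` (C2) and `r(U) ≥ 5` once `|U| ≥ 11` (C3) — with ONE
MORE CONSEQUENCE DRAWN: for `3 ≤ m` and `ν ≥ 7` the bound `|U| ≥ 4 + ν ≥ 11` already triggers (C3), so `r(U) ≥ 5` and
`(ν + 2)·m ≤ 3F` for every `m ≥ 3` (p8's `StepOK` has `(ν + 1)·m ≤ 3F` for `3 ≤ m ≤ 4`). So `m` satisfies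
`StepOKC (ν − 1) F m` with `F := triBound8C (ν − 1)`, i.e. `m ≤ stepRC (ν − 1) F`, and **`s₃ ≤ triBound8C ν`**
(`ncard_triangles_le_triBound8C`): `0, 1, 2, 4, 6, 8, 11, 14, 18, 22, 27, 33, …` — `18` against `19` at `ν = 8`.
(C3) passes to deletions and restrictions as (C1) and (C2) do. Axioms: standard.
-/

open scoped Matroid

namespace PercRepro

namespace S1

open Set

variable {α : Type}

/-- **THE (C3)-REFINED BOOTSTRAPPED TRIANGLE COUNT.** If `|E| = r(E) + d`, every rank-`2` set has at most `3` elements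
(C1), every rank-`≤ 3` set at most `6` (C2) and every rank-`≤ 4` set at most `10` (C3), then
`#(triangles M) ≤ triBound8C d`. -/
theorem ncard_triangles_le_triBound8C (M : Matroid α) [M.Finite]
    (hC1 : ∀ L ⊆ M.E, M.eRk L = 2 → L.ncard ≤ 3)
    (hC2 : ∀ X ⊆ M.E, M.eRk X ≤ 3 → X.ncard ≤ 6)
    (hC3 : ∀ X ⊆ M.E, M.eRk X ≤ 4 → X.ncard ≤ 10) {d : ℕ} (hd : M.E.encard = M.eRank + d) :
    (ThmN.triangles M).ncard ≤ triBound8C d := by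
  suffices H : ∀ n : ℕ, ∀ (M : Matroid α) [M.Finite], M.E.ncard = n →
      (∀ L ⊆ M.E, M.eRk L = 2 → L.ncard ≤ 3) → (∀ X ⊆ M.E, M.eRk X ≤ 3 → X.ncard ≤ 6) →
      (∀ X ⊆ M.E, M.eRk X ≤ 4 → X.ncard ≤ 10) →
      ∀ d : ℕ, M.E.encard = M.eRank + d → (ThmN.triangles M).ncard ≤ triBound8C d from
    H _ M rfl hC1 hC2 hC3 d hd
  intro n
  induction n using Nat.strong_induction_on with
  | _ n ih =>
  intro M _ hn hC1 hC2 hC3 d hd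
  classical
  -- small nullity: the re-based count and the two kernels
  rcases Nat.lt_or_ge d 5 with hd5 | hd5
  · have h := ncard_triangles_le_triBound6 M hC1 hC2 hd
    rw [triBound8C_eq_triBound6_of_le_four (by omega)]
    exact h
  rcases Nat.eq_or_lt_of_le hd5 with hd5' | hd6
  · subst hd5'
    exact ncard_triangles_le_eight_of_nullity_five M hC1 hC2 (by exact_mod_cast hd)
  -- nullity `≥ 6`: the deletion step with the refined constraint
  set S := ThmN.triangles M with hS
  have hSfin : S.Finite :=
    M.ground_finite.finite_subsets.subset (fun C hC => hC.1.subset_ground)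
  by_cases hSe : S = ∅
  · rw [hSe, ncard_empty]; exact Nat.zero_le _
  -- the point on the fewest triangles
  have hUE : ⋃₀ S ⊆ M.E := by
    intro z hz
    obtain ⟨C, hC, hzC⟩ := Set.mem_sUnion.1 hz
    exact hC.1.subset_ground hzC
  have hUfin : (⋃₀ S).Finite := M.ground_finite.subset hUE
  set Uf : Finset α := hUfin.toFinset with hUf
  have hmemU : ∀ x, x ∈ Uf ↔ x ∈ ⋃₀ S := fun x => Set.Finite.mem_toFinset hUfin
  have hUne : Uf.Nonempty := by
    obtain ⟨C₀, hC₀⟩ := nonempty_iff_ne_empty.2 hSe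
    obtain ⟨e, heC₀⟩ := hC₀.1.nonempty
    exact ⟨e, (hmemU e).2 (Set.mem_sUnion.2 ⟨C₀, hC₀, heC₀⟩)⟩
  obtain ⟨x, hxU, hxmin⟩ := Finset.exists_min_image Uf (fun y => (ThmN.trianglesThrough M y).ncard) hUne
  have hxU' : x ∈ ⋃₀ S := (hmemU x).1 hxU
  obtain ⟨C₀, hC₀, hxC₀⟩ := Set.mem_sUnion.1 hxU'
  set m := (ThmN.trianglesThrough M x).ncard with hm
  have hmin : ∀ y ∈ ⋃₀ ThmN.triangles M, m ≤ (ThmN.trianglesThrough M y).ncard :=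
    fun y hy => hxmin y ((hmemU y).2 hy)
  have heE : x ∈ M.E := hC₀.1.subset_ground hxC₀
  have hne : ¬ M.IsColoop x := hC₀.1.not_isColoop_of_mem hxC₀
  have hx : M.IsNonloop x := by
    refine _root_.Matroid.isNonloop_of_not_isLoop heE ?_
    intro hloop
    have hC₀e : C₀ = {x} := hloop.eq_of_isCircuit_mem hC₀.1 hxC₀
    have := hC₀.2
    rw [hC₀e, ncard_singleton] at this
    omega
  -- the nullity of `M ＼ {x}` is `d − 1`
  have hν : M✶.eRank = (d : ℕ∞) := by
    have h := _root_.Matroid.eRank_add_eRank_dual M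
    rw [hd] at h
    exact WithTop.add_left_cancel (PercRepro.Matroid.eRank_ne_top_of_finite M) h
  have hdel := PercRepro.Matroid.dual_eRank_delete_singleton_add_one heE hne
  rw [hν] at hdel
  have hfin' : (M ＼ {x})✶.eRank ≠ ⊤ := by
    intro h
    rw [h] at hdel
    exact absurd hdel (by simp)
  obtain ⟨d', hd'⟩ := ENat.ne_top_iff_exists.1 hfin'
  have hdd' : d = d' + 1 := by
    rw [← hd'] at hdel
    exact_mod_cast hdel.symm
  have hd'enc : (M ＼ {x}).E.encard = (M ＼ {x}).eRank + d' := by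
    have h := _root_.Matroid.eRank_add_eRank_dual (M ＼ {x})
    rw [← hd'] at h
    exact h.symm
  have hdelE : (M ＼ {x}).E.ncard < n := by
    rw [_root_.Matroid.delete_ground, ← hn, ← ncard_sdiff_singleton_add_one heE M.ground_finite]
    omega
  have hC1' : ∀ L ⊆ (M ＼ {x}).E, (M ＼ {x}).eRk L = 2 → L.ncard ≤ 3 := by
    intro L hL hr
    rw [_root_.Matroid.delete_ground] at hL
    rw [delete_singleton_eRk_eq hL] at hr
    exact hC1 L (hL.trans sdiff_subset) hr
  have hC2' : ∀ X ⊆ (M ＼ {x}).E, (M ＼ {x}).eRk X ≤ 3 → X.ncard ≤ 6 := by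
    intro X hX hr
    rw [_root_.Matroid.delete_ground] at hX
    rw [delete_singleton_eRk_eq hX] at hr
    exact hC2 X (hX.trans sdiff_subset) hr
  have hC3' : ∀ X ⊆ (M ＼ {x}).E, (M ＼ {x}).eRk X ≤ 4 → X.ncard ≤ 10 := by
    intro X hX hr
    rw [_root_.Matroid.delete_ground] at hX
    rw [delete_singleton_eRk_eq hX] at hr
    exact hC3 X (hX.trans sdiff_subset) hr
  -- (a) `s₃ ≤ m + triBound8 d'`
  set F := triBound8C d' with hF
  set S₁ := ThmN.trianglesThrough M x with hS₁
  set S₂ := {C | M.IsCircuit C ∧ C.ncard = 3 ∧ x ∉ C} with hS₂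
  have hsplit : S ⊆ S₁ ∪ S₂ := by
    intro C hC
    by_cases h : x ∈ C
    · exact Or.inl ⟨hC.1, hC.2, h⟩
    · exact Or.inr ⟨hC.1, hC.2, h⟩
  have hS₁fin : S₁.Finite := hSfin.subset (fun C hC => ⟨hC.1, hC.2.1⟩)
  have hS₂fin : S₂.Finite := hSfin.subset (fun C hC => ⟨hC.1, hC.2.1⟩)
  have h3 : S.ncard ≤ S₁.ncard + S₂.ncard :=
    (ncard_le_ncard hsplit (hS₁fin.union hS₂fin)).trans (ncard_union_le _ _)
  have hsub : S₂ ⊆ ThmN.triangles (M ＼ {x}) := by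
    intro C hC
    exact ⟨_root_.Matroid.delete_isCircuit_iff.2 ⟨hC.1, disjoint_singleton_right.2 hC.2.2⟩, hC.2.1⟩
  have hS₂ : S₂.ncard ≤ F :=
    (ncard_le_ncard hsub
      ((M ＼ {x}).ground_finite.finite_subsets.subset (fun C hC => hC.1.subset_ground))).trans
      (ih _ hdelE (M ＼ {x}) rfl hC1' hC2' hC3' d' hd'enc)
  have ha : S.ncard ≤ m + F := by omega
  -- (b) the star and the double count
  have hstar : 1 + 2 * m ≤ (⋃₀ S).ncard := one_add_two_mul_ncard_trianglesThrough_le M hC1 hx hxU'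
  have hdc : (⋃₀ S).ncard * m ≤ 3 * S.ncard := ncard_sUnion_mul_le_three_mul_ncard_triangles M hmin
  have hc : 2 * m * m ≤ 2 * m + 3 * F := by
    have h1 : (1 + 2 * m) * m ≤ (⋃₀ S).ncard * m := Nat.mul_le_mul_right m hstar
    have h2 : (1 + 2 * m) * m = m + 2 * m * m := by ring
    rw [h2] at h1
    have h3 : 3 * S.ncard ≤ 3 * m + 3 * F := by omega
    omega
  -- the target: `s₃ ≤ F + stepR d' F`
  have hrec : triBound8C d = F + stepRC d' F := by
    rw [hdd', triBound8C_succ d' (by omega)]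
  rw [hrec]
  -- (c) the restriction step: either the restriction to `U` has smaller nullity, or `|U| ≥ r(U) + d`
  have hrfin : M.eRk (⋃₀ S) ≠ ⊤ := by
    intro h
    have := M.eRk_le_encard (⋃₀ S)
    rw [h] at this
    exact hUfin.encard_lt_top.ne (top_le_iff.1 this)
  obtain ⟨r, hr⟩ := ENat.ne_top_iff_exists.1 hrfin
  have hkey : S.ncard ≤ F ∨ r + d ≤ (⋃₀ S).ncard := by
    set R := M ↾ (⋃₀ S) with hR
    haveI hRfinite : R.Finite := _root_.Matroid.restrict_finite hUfin
    have hRtri : ThmN.triangles R = ThmN.triangles M := by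
      ext C
      show R.IsCircuit C ∧ C.ncard = 3 ↔ M.IsCircuit C ∧ C.ncard = 3
      rw [hR, _root_.Matroid.restrict_isCircuit_iff hUE]
      constructor
      · rintro ⟨⟨hC, -⟩, h3⟩
        exact ⟨hC, h3⟩
      · rintro ⟨hC, h3⟩
        exact ⟨⟨hC, fun z hz => Set.mem_sUnion.2 ⟨C, ⟨hC, h3⟩, hz⟩⟩, h3⟩
    have hRC1 : ∀ L ⊆ R.E, R.eRk L = 2 → L.ncard ≤ 3 := by
      intro L hL hr
      rw [hR, _root_.Matroid.restrict_ground_eq] at hL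
      rw [hR, _root_.Matroid.restrict_eRk_eq M hL] at hr
      exact hC1 L (hL.trans hUE) hr
    have hRC2 : ∀ X ⊆ R.E, R.eRk X ≤ 3 → X.ncard ≤ 6 := by
      intro X hX hr
      rw [hR, _root_.Matroid.restrict_ground_eq] at hX
      rw [hR, _root_.Matroid.restrict_eRk_eq M hX] at hr
      exact hC2 X (hX.trans hUE) hr
    have hRC3 : ∀ X ⊆ R.E, R.eRk X ≤ 4 → X.ncard ≤ 10 := by
      intro X hX hr
      rw [hR, _root_.Matroid.restrict_ground_eq] at hX
      rw [hR, _root_.Matroid.restrict_eRk_eq M hX] at hr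
      exact hC3 X (hX.trans hUE) hr
    have hRfin : R✶.eRank ≠ ⊤ := PercRepro.Matroid.eRank_ne_top_of_finite R✶
    obtain ⟨dU, hdU⟩ := ENat.ne_top_iff_exists.1 hRfin
    have hdUenc : R.E.encard = R.eRank + dU := by
      have h := _root_.Matroid.eRank_add_eRank_dual R
      rw [← hdU] at h
      exact h.symm
    have hnat : (⋃₀ S).ncard = r + dU := by
      have h := hdUenc
      rw [hR, _root_.Matroid.restrict_ground_eq, _root_.Matroid.eRank_restrict, ← hr,
        ← hUfin.cast_ncard_eq] at h
      exact_mod_cast h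
    rcases Nat.lt_or_ge dU d with hlt | hge
    · -- the restriction has smaller nullity: the induction hypothesis on `R`
      left
      have hUlt : (⋃₀ S).ncard < n := by
        rcases Nat.lt_or_ge (⋃₀ S).ncard n with h | h
        · exact h
        · exfalso
          have hUeqE : ⋃₀ S = M.E :=
            Set.eq_of_subset_of_ncard_le hUE (by omega) M.ground_finite
          have hReq : R = M := by rw [hR, hUeqE, _root_.Matroid.restrict_ground_eq_self]
          rw [hReq] at hdUenc
          rw [hd] at hdUenc
          have := WithTop.add_left_cancel (PercRepro.Matroid.eRank_ne_top_of_finite M) hdUenc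
          have hdeq : d = dU := ENat.coe_inj.1 this
          omega
      have hb := ih _ hUlt R rfl hRC1 hRC2 hRC3 dU hdUenc
      rw [hRtri] at hb
      exact hb.trans (triBound8C_mono (by omega))
    · right
      omega
  rcases hkey with hle | hge
  · exact hle.trans (Nat.le_add_right _ _)
  -- (d) the refined constraint on `m`
  have hU7 : 3 ≤ m → 7 ≤ (⋃₀ S).ncard := fun h3 => by omega
  have hU11 : 5 ≤ m → 11 ≤ (⋃₀ S).ncard := fun h5 => by omega
  have hr4 : 3 ≤ m → 4 ≤ r := by
    intro h3
    by_contra h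
    push Not at h
    have h3' : M.eRk (⋃₀ S) ≤ 3 := by
      rw [← hr]
      exact_mod_cast (show r ≤ 3 by omega)
    have := hC2 _ hUE h3'
    have := hU7 h3
    omega
  have hr5 : 5 ≤ m → 5 ≤ r := by
    intro h5
    by_contra h
    push Not at h
    have h4' : M.eRk (⋃₀ S) ≤ 4 := by
      rw [← hr]
      exact_mod_cast (show r ≤ 4 by omega)
    have := hC3 _ hUE h4'
    have := hU11 h5
    omega
  -- the refined clause: for `3 ≤ m` at `d' ≥ 6`, `|U| ≥ 4 + d ≥ 11` forces `r ≥ 5` (C3), so `(d' + 3)·m ≤ 3F`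
  have hr5' : 3 ≤ m → 6 ≤ d' → 5 ≤ r := by
    intro h3 hd6
    have h4 := hr4 h3
    by_contra h
    push Not at h
    have h4' : M.eRk (⋃₀ S) ≤ 4 := by
      rw [← hr]
      exact_mod_cast (show r ≤ 4 by omega)
    have := hC3 _ hUE h4'
    omega
  have hrefined : 3 ≤ m → 6 ≤ d' → (d' + 3) * m ≤ 3 * F := by
    intro h3 hd6
    have h5r := hr5' h3 hd6
    have h1 : (r + d) * m ≤ 3 * S.ncard := (Nat.mul_le_mul_right m hge).trans hdc
    have h2 : 3 * S.ncard ≤ 3 * m + 3 * F := by omega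
    have h5 : (d' + 6) * m ≤ (r + d) * m := Nat.mul_le_mul_right m (by omega)
    nlinarith [h1, h2, h5]
  have hok : StepOKC d' F m := by
    refine ⟨⟨hc, ?_⟩, hrefined⟩
    rcases Nat.lt_or_ge m 3 with hm2 | hm3
    · exact Or.inl (by omega)
    rcases Nat.lt_or_ge m 5 with hm4 | hm5
    · refine Or.inr (Or.inl ⟨hm3, by omega, ?_⟩)
      have h4 := hr4 hm3
      have h1 : (r + d) * m ≤ 3 * S.ncard := (Nat.mul_le_mul_right m hge).trans hdc
      have h2 : 3 * S.ncard ≤ 3 * m + 3 * F := by omega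
      have h5 : (d' + 5) * m ≤ (r + d) * m := Nat.mul_le_mul_right m (by omega)
      nlinarith [h1, h2, h5]
    · refine Or.inr (Or.inr ⟨hm5, ?_⟩)
      have h5r := hr5 hm5
      have h1 : (r + d) * m ≤ 3 * S.ncard := (Nat.mul_le_mul_right m hge).trans hdc
      have h2 : 3 * S.ncard ≤ 3 * m + 3 * F := by omega
      have h5 : (d' + 6) * m ≤ (r + d) * m := Nat.mul_le_mul_right m (by omega)
      nlinarith [h1, h2, h5]
  have hmt : m ≤ stepRC d' F := le_stepRC_of hok
  omega

end S1

end PercRepro
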